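import Literature.AnabelianGeometry.SemiGraphs.TemperedSpecialFibreTower
import Literature.AnabelianGeometry.SemiGraphs.TemperedCompactInVerticialAt
import Literature.AnabelianGeometry.SemiGraphs.TemperedVerticialDistinctSameVertex
import Literature.AnabelianGeometry.SemiGraphs.TemperedVerticialNamedFactsProofs
import HarnessLib

/-!
# The action of `Π` on the vertices of the special fibres of the tower ([SemiAnbd] Ex. 3.10 / [IUTchI] §2):
# `actVertex`, DERIVED from the normality of the admissible kernels and Thm. 3.7 (ii), (iv)

Mochizuki, *Semi-graphs of anabelioids*, Publ. RIMS **42** (2006), §3, Example 3.10, manuscript p. 44 l. 12–17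
[cite: MochizukiSemiAnbd2006, Ex 3.10 p.44] ("semi-graphs of anabelioids `𝒢_i`, `𝒢^c_i` on which `Δ_i` acts
faithfully … natural morphisms of temperoids … compatible with the actions"), with Thm. 3.7 (ii), (iv) pp. 40–41; and
S. Mochizuki, *Inter-universal Teichmüller theory I*, §2, proof of Prop. 2.4 (i) p. 50 l. 27–30 (the action of
`Π^tp_X` on the special fibre `𝔾_J` of `X_J`, through `Π^tp_X/J`) [cite: Mochizuki2012, Prop 2.4(i) p.50].

abc-iut cell, seat abc-iut-L3-t2 gen 3, GAP-LEDGER row **G-w4d063-1 part (a) / item (P1)** (L3-lead gen 5 α25 (6)):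
for a special-fibre tower `T : SpecialFibreTower Δ` (seat abc-iut-w5-d122's structure) of a NORMAL subgroup `Δ ≤ Π` of
a topological group and the binder (P0) `hP0 : ∀ i, ((T.admKer i).map Δ.subtype).Normal` (the admissible kernels are
normal in `Π`, not only in `Δ` — [IUTchI] p. 50: `X_J → X_K` is Galois; a field of the successor record `PiData`),
this file DEFINES
* `SpecialFibreTower.conjDelta g : Δ ≃ₜ* Δ` — conjugation by `g ∈ Π`; the `N_i` are `Π`-normal (`N_char`);
* `SpecialFibreTower.autOfConj hP0 i g : π₁^temp(𝒢_i) ≃ₜ* π₁^temp(𝒢_i)` — THE automorphism of the chart group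
  `(T.chart i).G = N_i / admKer i` induced by `n ↦ g n g⁻¹` through the open surjection `adm i`
  (`autOfConj_adm`), multiplicative in `g`, INNER for `g ∈ N_i`;
* `SpecialFibreTower.actVertex hP0 i hiv : Π →* Equiv.Perm (T.Gc i).graph.Vertex` — the action of `Π` on the
  vertices of `𝒢_i`: `g · v :=` the unique vertex `w` such that `autOfConj g` carries the verticial subgroups at `v`
  to verticial subgroups at `w` (DICTIONARY `actVertex_apply_eq_iff`),
and PROVES that it is well defined and a homomorphism from [SemiAnbd] Thm. 3.7 (iv) AT `𝒢_i` («maximal compact =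
verticial»; binder `hiv : MaximalCompactIffVerticialAt (T.Gc i)` — a THEOREM for finite `𝔾_i`, seat abc-iut-L3-t8's
`maximalCompactIffVerticialAt_of_finiteGraph`, so at the special fibres of a curve the binder is discharged by
finiteness) and Thm. 3.7 (ii) («distinct vertices ⇒ distinct verticial subgroups», `verticialDistinct_holds`, in the
tree), together with **B1 (a) of seat abc-iut-L5-t11's sub-DAG, PROVED**: `N_i` acts trivially
(`actVertex_coe_eq_one`).  NOTE: Cor. 3.9 is NOT used (the `𝒢^c_i` carry open edges = cusps and are not graphs);
Thm. 3.7 (ii)+(iv) suffice for the VERTEX action.  Items (P2)/(P3) of the row (sub-semi-graph `ℍ`, covering maps,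
cusp incidence) are origin data of the successor record (companion, director's DEF window).  DEFS-bearing witness of
an interface item («DEF NEW» posted); no instance, no notation, no `Prop` fact; nothing here bears on [IUTchIII]
Cor. 3.12.
-/

noncomputable section

namespace Literature.AnabelianGeometry.SemiGraphs

open ProfiniteSemiGraph Topology
open scoped Pointwise

universe u

namespace SpecialFibreTower

variable {Γ : Type u} [Group Γ] [TopologicalSpace Γ] [IsTopologicalGroup Γ] {Δ : Subgroup Γ} [hΔ : Δ.Normal]
  (T : SpecialFibreTower Δ)

/-! ### (a0) Conjugation by `Π` on `Δ` and on the levels `N_i` -/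

/-- Conjugation by `g ∈ Π` on the normal subgroup `Δ`, as a topological-group automorphism of `Δ`.
[cite: MochizukiSemiAnbd2006, Ex 3.10 p.44] -/
def conjDelta (g : Γ) : Δ ≃ₜ* Δ where
  toFun h := ⟨g * h * g⁻¹, hΔ.conj_mem _ h.2 g⟩
  invFun h := ⟨g⁻¹ * h * g⁻¹⁻¹, hΔ.conj_mem _ h.2 g⁻¹⟩
  left_inv h := Subtype.ext (by simp only [inv_inv]; group)
  right_inv h := Subtype.ext (by simp only [inv_inv]; group)
  map_mul' h k := Subtype.ext (by simp only [Subgroup.coe_mul]; group)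
  continuous_toFun := by
    apply Continuous.subtype_mk
    exact (continuous_const.mul continuous_subtype_val).mul continuous_const
  continuous_invFun := by
    apply Continuous.subtype_mk
    exact (continuous_const.mul continuous_subtype_val).mul continuous_const

/-- `conjDelta g h = g h g⁻¹`. [cite: MochizukiSemiAnbd2006, Ex 3.10 p.44] -/
@[simp] theorem coe_conjDelta (g : Γ) (h : Δ) : ((conjDelta (Δ := Δ) g h : Δ) : Γ) = g * h * g⁻¹ := rfl

/-- The levels `N_i` are normal in `Π`: `N_i` is characteristic in `Δ` (`N_char`) and `Δ` is normal in `Π`.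
[cite: MochizukiSemiAnbd2006, Ex 3.10 p.44] -/
theorem conjDelta_mem_N (i : ℕ) (g : Γ) {n : Δ} (hn : n ∈ T.N i) : conjDelta g n ∈ T.N i := by
  have h := T.N_char i (conjDelta g)
  rw [← h]
  exact ⟨n, hn, rfl⟩

/-- Conjugation by `g` restricted to the level `N_i`. [cite: MochizukiSemiAnbd2006, Ex 3.10 p.44] -/
def conjN (i : ℕ) (g : Γ) : T.N i →* T.N i where
  toFun n := ⟨conjDelta g (n : Δ), T.conjDelta_mem_N i g n.2⟩
  map_one' := Subtype.ext (by simp)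
  map_mul' n m := Subtype.ext (by simp)

/-- `conjN` is continuous. [cite: MochizukiSemiAnbd2006, Ex 3.10 p.44] -/
theorem continuous_conjN (i : ℕ) (g : Γ) : Continuous (T.conjN i g) :=
  Continuous.subtype_mk ((conjDelta g).continuous.comp continuous_subtype_val) _

/-- `conjN i 1 = id`. [cite: MochizukiSemiAnbd2006, Ex 3.10 p.44] -/
theorem conjN_one (i : ℕ) (n : T.N i) : T.conjN i 1 n = n := by
  apply Subtype.ext; apply Subtype.ext
  simp [conjN]

/-- `conjN i (g h) = conjN i g ∘ conjN i h`. [cite: MochizukiSemiAnbd2006, Ex 3.10 p.44] -/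
theorem conjN_mul (i : ℕ) (g h : Γ) (n : T.N i) : T.conjN i (g * h) n = T.conjN i g (T.conjN i h n) :=
  Subtype.ext (Subtype.ext (by simp only [conjN, MonoidHom.coe_mk, OneHom.coe_mk, coe_conjDelta]; group))

/-! ### (a1) The induced automorphism of `π₁^temp(𝒢_i) = N_i / admKer i` -/

section Aut

/-- Under (P0), conjugation by `g ∈ Π` preserves the admissible kernel `admKer i ≤ Δ`.
[cite: MochizukiSemiAnbd2006, Ex 3.10 p.45] -/
theorem conjDelta_mem_admKer (hP0 : ∀ i, ((T.admKer i).map Δ.subtype).Normal) (i : ℕ) (g : Γ) {n : Δ} (hn : n ∈ T.admKer i) : conjDelta g n ∈ T.admKer i := by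
  have h1 : ((n : Δ) : Γ) ∈ (T.admKer i).map Δ.subtype := ⟨n, hn, rfl⟩
  have h2 := (hP0 i).conj_mem _ h1 g
  obtain ⟨m, hm, hmeq⟩ := h2
  have : m = conjDelta g n := Subtype.ext (by rw [coe_conjDelta]; exact hmeq)
  rw [← this]; exact hm

/-- `adm i ∘ conjN i g` kills `Ker (adm i)` (= `admKer i ∩ N_i`). [cite: MochizukiSemiAnbd2006, Ex 3.10 p.45] -/
theorem ker_adm_le_ker_comp (hP0 : ∀ i, ((T.admKer i).map Δ.subtype).Normal) (i : ℕ) (g : Γ) :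
    (T.adm i).toMonoidHom.ker ≤ ((T.adm i).toMonoidHom.comp (T.conjN i g)).ker := by
  intro n hn
  rw [T.ker_adm i, Subgroup.mem_subgroupOf] at hn
  rw [MonoidHom.mem_ker, MonoidHom.comp_apply]
  have hmem : ((T.conjN i g n : T.N i) : Δ) ∈ T.admKer i := T.conjDelta_mem_admKer hP0 i g hn
  have : T.conjN i g n ∈ (T.adm i).toMonoidHom.ker := by
    rw [T.ker_adm i, Subgroup.mem_subgroupOf]; exact hmem
  exact this

/-- The endomorphism of the chart group induced by conjugation by `g` (as a bare homomorphism): the lift of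
`adm i ∘ conjN i g` along the surjection `adm i`. [cite: MochizukiSemiAnbd2006, Ex 3.10 p.45] -/
def autHom (hP0 : ∀ i, ((T.admKer i).map Δ.subtype).Normal) (i : ℕ) (g : Γ) : (T.chart i).G →* (T.chart i).G :=
  (T.adm i).toMonoidHom.liftOfSurjective (T.adm_surjective i)
    ⟨(T.adm i).toMonoidHom.comp (T.conjN i g), T.ker_adm_le_ker_comp hP0 i g⟩

/-- The defining square: `autHom g (adm n) = adm (g n g⁻¹)`. [cite: MochizukiSemiAnbd2006, Ex 3.10 p.45] -/
theorem autHom_adm (hP0 : ∀ i, ((T.admKer i).map Δ.subtype).Normal) (i : ℕ) (g : Γ) (n : T.N i) : T.autHom hP0 i g (T.adm i n) = T.adm i (T.conjN i g n) :=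
  MonoidHom.liftOfRightInverse_comp_apply _ _ _ _ n

/-- `autHom 1 = id`. [cite: MochizukiSemiAnbd2006, Ex 3.10 p.45] -/
theorem autHom_one (hP0 : ∀ i, ((T.admKer i).map Δ.subtype).Normal) (i : ℕ) (x : (T.chart i).G) : T.autHom hP0 i 1 x = x := by
  obtain ⟨n, rfl⟩ := T.adm_surjective i x
  rw [autHom_adm, conjN_one]

/-- `autHom (g h) = autHom g ∘ autHom h`. [cite: MochizukiSemiAnbd2006, Ex 3.10 p.45] -/
theorem autHom_mul (hP0 : ∀ i, ((T.admKer i).map Δ.subtype).Normal) (i : ℕ) (g h : Γ) (x : (T.chart i).G) :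
    T.autHom hP0 i (g * h) x = T.autHom hP0 i g (T.autHom hP0 i h x) := by
  obtain ⟨n, rfl⟩ := T.adm_surjective i x
  rw [autHom_adm, autHom_adm, autHom_adm, conjN_mul]

/-- `autHom g` is continuous: `adm i` is an open continuous surjection, hence a quotient map, and
`autHom g ∘ adm i = adm i ∘ conjN i g` is continuous. [cite: MochizukiSemiAnbd2006, Ex 3.10 p.45] -/
theorem continuous_autHom (hP0 : ∀ i, ((T.admKer i).map Δ.subtype).Normal) (i : ℕ) (g : Γ) : Continuous (T.autHom hP0 i g) := by
  have hq : IsQuotientMap (T.adm i) :=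
    IsOpenMap.isQuotientMap (T.isOpenMap_adm i) (T.adm i).continuous (T.adm_surjective i)
  rw [hq.continuous_iff]
  have : (T.autHom hP0 i g) ∘ (T.adm i) = (T.adm i) ∘ (T.conjN i g) := funext fun n => T.autHom_adm hP0 i g n
  rw [this]
  exact (T.adm i).continuous.comp (T.continuous_conjN i g)

/-- **The automorphism of `π₁^temp(𝒢_i)` induced by conjugation by `g ∈ Π`** ([IUTchI] p. 50: the action of
`Π^tp_X` on the special fibre of `X_J` through `Π^tp_X/J`), a topological-group automorphism of the chart group.
[cite: Mochizuki2012, Prop 2.4(i) p.50] -/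
def autOfConj (hP0 : ∀ i, ((T.admKer i).map Δ.subtype).Normal) (i : ℕ) (g : Γ) : (T.chart i).G ≃ₜ* (T.chart i).G where
  toFun := T.autHom hP0 i g
  invFun := T.autHom hP0 i g⁻¹
  left_inv x := by rw [← autHom_mul, inv_mul_cancel, autHom_one]
  right_inv x := by rw [← autHom_mul, mul_inv_cancel, autHom_one]
  map_mul' := map_mul _
  continuous_toFun := T.continuous_autHom hP0 i g
  continuous_invFun := T.continuous_autHom hP0 i g⁻¹

/-- `autOfConj g (adm n) = adm (g n g⁻¹)`. [cite: MochizukiSemiAnbd2006, Ex 3.10 p.45] -/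
theorem autOfConj_adm (hP0 : ∀ i, ((T.admKer i).map Δ.subtype).Normal) (i : ℕ) (g : Γ) (n : T.N i) : T.autOfConj hP0 i g (T.adm i n) = T.adm i (T.conjN i g n) :=
  T.autHom_adm hP0 i g n

/-- `autOfConj 1 = id`. [cite: MochizukiSemiAnbd2006, Ex 3.10 p.45] -/
theorem autOfConj_one (hP0 : ∀ i, ((T.admKer i).map Δ.subtype).Normal) (i : ℕ) (x : (T.chart i).G) : T.autOfConj hP0 i 1 x = x := T.autHom_one hP0 i x

/-- `autOfConj (g h) = autOfConj g ∘ autOfConj h`. [cite: MochizukiSemiAnbd2006, Ex 3.10 p.45] -/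
theorem autOfConj_mul (hP0 : ∀ i, ((T.admKer i).map Δ.subtype).Normal) (i : ℕ) (g h : Γ) (x : (T.chart i).G) :
    T.autOfConj hP0 i (g * h) x = T.autOfConj hP0 i g (T.autOfConj hP0 i h x) := T.autHom_mul hP0 i g h x

/-- For `n ∈ N_i`, `autOfConj n` is INNER: conjugation by `adm n`. [cite: MochizukiSemiAnbd2006, Ex 3.10 p.45] -/
theorem autOfConj_coe (hP0 : ∀ i, ((T.admKer i).map Δ.subtype).Normal) (i : ℕ) (n : T.N i) (x : (T.chart i).G) :
    T.autOfConj hP0 i ((n : Δ) : Γ) x = T.adm i n * x * (T.adm i n)⁻¹ := by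
  obtain ⟨m, rfl⟩ := T.adm_surjective i x
  rw [autOfConj_adm]
  have : T.conjN i ((n : Δ) : Γ) m = n * m * n⁻¹ :=
    Subtype.ext (Subtype.ext (by simp [conjN]))
  rw [this, map_mul, map_mul, map_inv]

end Aut

/-! ### (a2) The action on the vertices of `𝒢_i` -/

section Vertices

/-- A topological-group automorphism carries maximal compact subgroups to maximal compact subgroups. [folklore] -/
private theorem isMaximalCompactSubgroup_map {G : Type u} [Group G] [TopologicalSpace G] [IsTopologicalGroup G]
    (e : G ≃ₜ* G) {K : Subgroup G} (hK : IsMaximalCompactSubgroup K) :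
    IsMaximalCompactSubgroup (K.map e.toMonoidHom) := by
  refine ⟨?_, fun K' hK' hle => ?_⟩
  · rw [Subgroup.coe_map]; exact hK.1.image e.continuous
  · -- pull `K'` back along `e`
    have hpre : IsCompact ((K'.map e.symm.toMonoidHom : Subgroup G) : Set G) := by
      rw [Subgroup.coe_map]; exact hK'.image e.symm.continuous
    have hKle : K ≤ K'.map e.symm.toMonoidHom := by
      intro k hk
      exact ⟨e k, hle ⟨k, hk, rfl⟩, e.symm_apply_apply k⟩
    have heq := hK.2 _ hpre hKle
    apply le_antisymm _ hle
    intro y hy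
    have : e.symm y ∈ K := by rw [← heq]; exact ⟨y, hy, rfl⟩
    exact ⟨e.symm y, this, e.apply_symm_apply y⟩

omit [IsTopologicalGroup Γ] hΔ in
/-- Verticial subgroups at DISTINCT vertices are distinct (Thm. 3.7 (ii): infinite mutual index).
[cite: MochizukiSemiAnbd2006, Thm 3.7(ii) p.40] -/
theorem vertex_eq_of_mem_verticialSubgroups (i : ℕ) {v w : (T.Gc i).graph.Vertex} {K : Subgroup (T.chart i).G}
    (hv : K ∈ verticialSubgroups (T.chart i) v) (hw : K ∈ verticialSubgroups (T.chart i) w) : v = w := by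
  by_contra hne
  have h := (verticialDistinct_holds (T.Gc i) (T.hyp i) (T.chart i)).1 v w K K hv hw hne
  rw [Subgroup.relIndex_self] at h
  exact one_ne_zero h

/-- The image of a verticial subgroup under `autOfConj g` is verticial at some vertex (Thm. 3.7 (iv) at `𝒢_i`:
verticial = maximal compact, a notion preserved by topological automorphisms). [cite: MochizukiSemiAnbd2006, Thm 3.7(iv) p.41] -/
theorem exists_vertex_map_autOfConj (hP0 : ∀ i, ((T.admKer i).map Δ.subtype).Normal) (i : ℕ) (hiv : MaximalCompactIffVerticialAt (T.Gc i)) (g : Γ) {v : (T.Gc i).graph.Vertex} {H : Subgroup (T.chart i).G}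
    (hH : H ∈ verticialSubgroups (T.chart i) v) :
    ∃ w, H.map (T.autOfConj hP0 i g).toMonoidHom ∈ verticialSubgroups (T.chart i) w := by
  have hmax : IsMaximalCompactSubgroup H := ((hiv (T.hyp i) (T.chart i)).1 H).2 ⟨v, hH⟩
  exact ((hiv (T.hyp i) (T.chart i)).1 _).1 (isMaximalCompactSubgroup_map (T.autOfConj hP0 i g) hmax)

omit [IsTopologicalGroup Γ] hΔ in
/-- A chosen verticial subgroup at each vertex (Thm. 3.7 (i): the verticial subgroups at `v` are nonempty).
[cite: MochizukiSemiAnbd2006, Thm 3.7(i) p.40] -/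
theorem verticialSubgroups_nonempty (i : ℕ) (v : (T.Gc i).graph.Vertex) : (verticialSubgroups (T.chart i) v).Nonempty :=
  (verticialInjective_holds (T.Gc i) (T.hyp i) (T.chart i) v).1

/-- The vertex `g · v` (as a bare function): the vertex carrying the `autOfConj g`-image of (a chosen) verticial
subgroup at `v`. [cite: Mochizuki2012, Prop 2.4(i) p.50] -/
def actFun (hP0 : ∀ i, ((T.admKer i).map Δ.subtype).Normal) (i : ℕ) (hiv : MaximalCompactIffVerticialAt (T.Gc i)) (g : Γ) (v : (T.Gc i).graph.Vertex) : (T.Gc i).graph.Vertex :=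
  (T.exists_vertex_map_autOfConj hP0 i hiv g (T.verticialSubgroups_nonempty i v).some_mem).choose

/-- Images of conjugates: `α(x H x⁻¹) = α(x) α(H) α(x)⁻¹`. [folklore] -/
private theorem map_conj_map {G : Type u} [Group G] [TopologicalSpace G] (e : G ≃ₜ* G) (H : Subgroup G) (x : G) :
    (H.map (MulAut.conj x).toMonoidHom).map e.toMonoidHom =
      (H.map e.toMonoidHom).map (MulAut.conj (e x)).toMonoidHom := by
  rw [Subgroup.map_map, Subgroup.map_map]
  congr 1
  ext y
  show e (x * y * x⁻¹) = e x * e y * (e x)⁻¹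
  rw [map_mul, map_mul, map_inv]

/-- **DICTIONARY, image form**: `autOfConj g` carries EVERY verticial subgroup at `v` to a verticial subgroup at
`g · v` (the verticial subgroups at `v` form one conjugacy class, and conjugates of verticial subgroups are
verticial). [cite: MochizukiSemiAnbd2006, Thm 3.7(i) p.40] -/
theorem map_mem_verticialSubgroups_actFun (hP0 : ∀ i, ((T.admKer i).map Δ.subtype).Normal) (i : ℕ) (hiv : MaximalCompactIffVerticialAt (T.Gc i)) (g : Γ) {v : (T.Gc i).graph.Vertex} {H : Subgroup (T.chart i).G}
    (hH : H ∈ verticialSubgroups (T.chart i) v) :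
    H.map (T.autOfConj hP0 i g).toMonoidHom ∈ verticialSubgroups (T.chart i) (T.actFun hP0 i hiv g v) := by
  have h₀ := (T.exists_vertex_map_autOfConj hP0 i hiv g (T.verticialSubgroups_nonempty i v).some_mem).choose_spec
  obtain ⟨x, rfl⟩ := exists_conj_of_mem_verticialSubgroups (T.chart i)
    (T.verticialSubgroups_nonempty i v).some_mem hH
  rw [map_conj_map]
  exact conj_mem_verticialSubgroups (T.chart i) h₀ _

/-- **DICTIONARY**: `g · v = w` iff `autOfConj g` carries every verticial subgroup at `v` to one at `w` (item (P1)
of G-w4d063-1). [cite: Mochizuki2012, Prop 2.4(i) p.50] -/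
theorem actFun_eq_iff (hP0 : ∀ i, ((T.admKer i).map Δ.subtype).Normal) (i : ℕ) (hiv : MaximalCompactIffVerticialAt (T.Gc i)) (g : Γ) (v w : (T.Gc i).graph.Vertex) :
    T.actFun hP0 i hiv g v = w ↔
      ∀ H ∈ verticialSubgroups (T.chart i) v,
        H.map (T.autOfConj hP0 i g).toMonoidHom ∈ verticialSubgroups (T.chart i) w := by
  constructor
  · rintro rfl H hH
    exact T.map_mem_verticialSubgroups_actFun hP0 i hiv g hH
  · intro h
    have h1 := T.map_mem_verticialSubgroups_actFun hP0 i hiv g (T.verticialSubgroups_nonempty i v).some_mem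
    exact T.vertex_eq_of_mem_verticialSubgroups i h1 (h _ (T.verticialSubgroups_nonempty i v).some_mem)

/-- `1 · v = v`. [cite: Mochizuki2012, Prop 2.4(i) p.50] -/
theorem actFun_one (hP0 : ∀ i, ((T.admKer i).map Δ.subtype).Normal) (i : ℕ) (hiv : MaximalCompactIffVerticialAt (T.Gc i)) (v : (T.Gc i).graph.Vertex) : T.actFun hP0 i hiv 1 v = v := by
  rw [actFun_eq_iff]
  intro H hH
  have : H.map (T.autOfConj hP0 i 1).toMonoidHom = H := by
    ext x
    constructor
    · rintro ⟨y, hy, rfl⟩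
      change T.autOfConj hP0 i 1 y ∈ H
      rw [autOfConj_one]; exact hy
    · intro hx
      exact ⟨x, hx, T.autOfConj_one hP0 i x⟩
  rw [this]; exact hH

/-- `(g h) · v = g · (h · v)`. [cite: Mochizuki2012, Prop 2.4(i) p.50] -/
theorem actFun_mul (hP0 : ∀ i, ((T.admKer i).map Δ.subtype).Normal) (i : ℕ) (hiv : MaximalCompactIffVerticialAt (T.Gc i)) (g h : Γ) (v : (T.Gc i).graph.Vertex) :
    T.actFun hP0 i hiv (g * h) v = T.actFun hP0 i hiv g (T.actFun hP0 i hiv h v) := by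
  rw [actFun_eq_iff]
  intro H hH
  have hcomp : H.map (T.autOfConj hP0 i (g * h)).toMonoidHom =
      (H.map (T.autOfConj hP0 i h).toMonoidHom).map (T.autOfConj hP0 i g).toMonoidHom := by
    rw [Subgroup.map_map]
    congr 1
    ext x
    exact T.autOfConj_mul hP0 i g h x
  rw [hcomp]
  exact T.map_mem_verticialSubgroups_actFun hP0 i hiv g (T.map_mem_verticialSubgroups_actFun hP0 i hiv h hH)

/-- **The action of `Π` on the vertices of `𝒢_i`** (item (P1) of G-w4d063-1; [IUTchI] p. 50 "the action of
`Π^tp_X` on `𝔾_J`"), a homomorphism into the permutations of the vertices. [cite: Mochizuki2012, Prop 2.4(i) p.50] -/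
def actVertex (hP0 : ∀ i, ((T.admKer i).map Δ.subtype).Normal) (i : ℕ) (hiv : MaximalCompactIffVerticialAt (T.Gc i)) : Γ →* Equiv.Perm (T.Gc i).graph.Vertex where
  toFun g :=
    { toFun := T.actFun hP0 i hiv g
      invFun := T.actFun hP0 i hiv g⁻¹
      left_inv := fun v => by rw [← actFun_mul, inv_mul_cancel, actFun_one]
      right_inv := fun v => by rw [← actFun_mul, mul_inv_cancel, actFun_one] }
  map_one' := Equiv.ext fun v => T.actFun_one hP0 i hiv v
  map_mul' g h := Equiv.ext fun v => T.actFun_mul hP0 i hiv g h v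

/-- `actVertex g v = actFun g v`. [cite: Mochizuki2012, Prop 2.4(i) p.50] -/
theorem actVertex_apply (hP0 : ∀ i, ((T.admKer i).map Δ.subtype).Normal) (i : ℕ) (hiv : MaximalCompactIffVerticialAt (T.Gc i)) (g : Γ) (v : (T.Gc i).graph.Vertex) :
    T.actVertex hP0 i hiv g v = T.actFun hP0 i hiv g v := rfl

/-- **DICTIONARY** for `actVertex` (= the (P1) law of G-w4d063-1). [cite: Mochizuki2012, Prop 2.4(i) p.50] -/
theorem actVertex_apply_eq_iff (hP0 : ∀ i, ((T.admKer i).map Δ.subtype).Normal) (i : ℕ) (hiv : MaximalCompactIffVerticialAt (T.Gc i)) (g : Γ) (v w : (T.Gc i).graph.Vertex) :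
    T.actVertex hP0 i hiv g v = w ↔
      ∀ H ∈ verticialSubgroups (T.chart i) v,
        H.map (T.autOfConj hP0 i g).toMonoidHom ∈ verticialSubgroups (T.chart i) w :=
  T.actFun_eq_iff hP0 i hiv g v w

/-- **B1 (a) (`LevelActsTrivially`) PROVED: `N_i` acts trivially on the vertices of `𝒢_i`** — for `n ∈ N_i`,
`autOfConj n` is inner, and inner automorphisms preserve every verticial conjugacy class.
[cite: Mochizuki2012, Prop 2.4(i) p.50] -/
theorem actVertex_coe_eq_one (hP0 : ∀ i, ((T.admKer i).map Δ.subtype).Normal) (i : ℕ) (hiv : MaximalCompactIffVerticialAt (T.Gc i)) (n : T.N i) : T.actVertex hP0 i hiv ((n : Δ) : Γ) = 1 := by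
  ext v
  change T.actFun hP0 i hiv ((n : Δ) : Γ) v = v
  rw [actFun_eq_iff]
  intro H hH
  have : H.map (T.autOfConj hP0 i ((n : Δ) : Γ)).toMonoidHom = H.map (MulAut.conj (T.adm i n)).toMonoidHom := by
    congr 1
    ext x
    show T.autOfConj hP0 i ((n : Δ) : Γ) x = T.adm i n * x * (T.adm i n)⁻¹
    exact T.autOfConj_coe hP0 i n x
  rw [this]
  exact conj_mem_verticialSubgroups (T.chart i) hH _

/-- `N_i` acts trivially, membership form: every `g ∈ Π` in the image of `N_i` acts as the identity.
[cite: Mochizuki2012, Prop 2.4(i) p.50] -/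
theorem actVertex_eq_one_of_mem (hP0 : ∀ i, ((T.admKer i).map Δ.subtype).Normal) (i : ℕ) (hiv : MaximalCompactIffVerticialAt (T.Gc i)) (g : Γ) (hg : g ∈ ((T.N i).map Δ.subtype : Subgroup Γ)) :
    T.actVertex hP0 i hiv g = 1 := by
  obtain ⟨d, hd, rfl⟩ := hg
  exact T.actVertex_coe_eq_one hP0 i hiv ⟨d, hd⟩

end Vertices

end SpecialFibreTower

end Literature.AnabelianGeometry.SemiGraphs

end
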